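import Literature.MathematicalPhysics.QuantumFieldTheory.Balaban1983to89.B1Eq218Model
import Literature.MathematicalPhysics.QuantumFieldTheory.Balaban1983to89.B1Eq338Display
import Literature.MathematicalPhysics.QuantumFieldTheory.Balaban1983to89.B1Eq331Model
import Literature.MathematicalPhysics.QuantumFieldTheory.Balaban1983to89.B1Eq31Concrete
import Literature.MathematicalPhysics.QuantumFieldTheory.Balaban1983to89.B2Eq246ScalarStep

/-!
# Bałaban, *(Higgs)₂,₃ quantum fields in a finite volume I*, CMP **85** (1982), Sect. 3: the basic quadratic form (3.17),
# the action (3.30) and the translation (3.48) WITH BODIES ON THE CONCRETE CARRIER, identified where print consumes them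

statement-level skeleton of published theorems with citation tags; proofs where landed; nothing here is a claim about the Yang–Mills mass gap

CITATION HEADER.  T. Bałaban, *(Higgs)₂,₃ quantum fields in a finite volume. I. A lower bound*, Commun. Math. Phys. **85**
(1982) 603–626 [Balaban1982Higgs1] (cell paper B1; PDF held `paper:balaban1982-cmp85-higgs23-i`, journal page = PDF page +
602; pp. 614–615, 617, 619, 621 read AS IMAGES on the ×2 renders `run/shared/lean/pub/pub-balaban/b2b-balaban-ref1/pages/
1982-cmp85-higgs23-I/1982-cmp85-higgs23-I-p012/p013/p015/p017/p019-x2.png`).  Unit `lit-balaban-r14` gen 23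
(literature-prover-lit-balaban-r14-g23-0; B1 fold owner; HOME `run/shared/lean/pub/lit-balaban/`).  SKELETON rows served (all
three carry r12's SCHEMATIC declarations of record in `B1Sect3Statements` — `action37` for (3.17)'s shape, `action330`,
`transl310`; ruling B1-1 — and were `typed`): **B1.Eq3.17**, **B1.Eq3.30**, **B1.Eq3.48**.  This file supplies, for each,
the display WITH BODY on the (Higgs)₂,₃ carrier (`HiggsLattice`/`HiggsAveraging`/`HiggsCovariance`, the typer's and p35's
operators BY NAME) and the kernel identification at the place where print CONSUMES the display.

WHAT IS PRINTED (verbatim; v1.1 restores the printed wording of the p. 615 / p. 621 passages — referee ref-3 N-g79-1 —,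
declarations and proofs unchanged).  p. 615 [PDF 13]: *"Thus we get an expression which is a polynomial in the fields
ψ, φ, A′. The basic quadratic form in the fields ψ, φ is equal ½aL^{d−2} Σ_{y∈T′₁} |ψ(y) − (Q(B^{(1)})φ)(y)|² + ½⟨φ,
(−Δ_{B^{(1)}} + m²ε²)φ⟩, (3.17) and the remaining terms are interaction terms with coefficients proportional to some power
of ε^{(4−d)/2}. Now we apply the translation in the fields φ φ = φ′ + aL⁻²C^{(0)}(B^{(1)})Q*(B^{(1)})ψ =: φ′ + ψ^{(1)} (3.18)
separating this quadratic form into a sum of two independent forms in the fields ψ, φ′ respectively: … = ½⟨ψ,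
Δ^{(1),L}(B^{(1)})ψ⟩ + ½⟨φ′, (C^{(0)}(B^{(1)}))⁻¹φ′⟩. (3.19)"*.  p. 617 [PDF 15]: *"The action has the form: S^{(k),L^kε}(A, φ) =
−log Z_k − log Z_k(A^{(k),ε}) + ½⟨A, Δ^{(k),L^kε}A⟩ + ½⟨φ, Δ^{(k),L^kε}(A^{(k),ε})φ⟩ − 𝒫^{(k),L^kε}(A^{(k),ε}, φ) + E₀, (3.30)
and for the factors Z_k, Z_k(A^{(k),ε}) we have the formulas: Z_k = (a_k(L^kε)^{d−2}/2π)^{(d/2)|T₁^{(k)}|} ∫dA exp(−½⟨A,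
(G^ε_k)⁻¹A⟩), (3.31)  Z_k(A^{(k),ε}) = (a_k(L^kε)^{d−2}/2π)^{(N/2)|T₁^{(k)}|} ∫dφ exp(−½⟨φ, (G^ε_k(A^{(k),ε}))⁻¹φ⟩). (3.32)"*
with (3.29) *"A^{(k),ε} = a_k(L^kε)⁻²G^ε_kQ_k*A"* and *"The most difficult task is to describe 𝒫^{(k),L^kε}(A^{(k),ε}, φ)."*
p. 621 [PDF 19]: *"Now we will do a translation in the fields φ. The translation has the form φ = φ′ +
aL⁻²C^{(k)}(B^{(k+1)})Q*(B^{(k+1)})ψ, (3.48) and it separates again the basic quadratic form for scalar fields into a sum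
of the corresponding forms in the fields ψ and φ′. The rest of the action changes in an obvious manner. Let us notice
that if (3.48) is done in φ^{(k)} = a_kG_k(B^{(k+1)})Q_k*(B^{(k+1)})φ, then we use (2.66), (3.70) and we get φ^{(k)} = φ′^{(k)}
+ ψ^{(k+1)}. (3.49)"* — the two "corresponding forms" being the ones displayed in (3.51) p. 621: `½⟨ψ, Δ^{(k+1),L}(B^{(k+1)})ψ⟩`
(in the prefactor) and `½⟨φ′, (C^{(k)}(B^{(k+1)}))⁻¹φ′⟩` (in the fluctuation exponent).

WHAT THIS FILE PROVIDES (0 `sorry`, 0 `Prop`-valued definitions; standard axioms).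
§1 (3.17): `form317` = the display WITH BODY at level 0 of the `ε`-family (`½·a(Lε)^{d−2}·Σ_y‖ψ(y) − (Q(B₁)φ)(y)‖² +
   ½⟨φ, (−Δ^{ε,N}_{B₁,Ω} + m²)φ⟩`, `Q(B₁)` = `HiggsAveraging.avgQ`, `−Δ + m²` = `HiggsCovariance.delta0`; on the unit lattice
   `P.unitAt 0` the prefactor is literally `aL^{d−2}` and `m²` ↤ `m²ε²`, `form317_unit`); IDENTIFIED with p34's joint exponent of
   the renormalization step (`form317_eq_half_jointExp`: `= ½·jointExp (a(Lε)^{d−2}) Q(B₁) ⟨·,Δ^{(0)}·⟩`, the exponent of the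
   integrand of `T_{a,L,B₁}[e^{−½⟨φ,Δ^{(0)}φ⟩}]` of (2.18)/(3.7)) and with the typer's II (2.45) letter (`form317_eq_neg_stepExp245`:
   `= −stepExp245 … 0`); CONSUMED at (3.18)–(3.19): **`form317_transl`** — after the translation by r14's `B1Eq218Model.statPt`
   (= `ψ^{(1)} = aL⁻²C^{(0)}(B₁)Q*(B₁)ψ`) the form splits as printed, `form317 ψ (ψ^{(1)} + φ′) = ½⟨φ′, (a(Lε)⁻²P(B₁) +
   Δ^{(0)})φ′⟩ + ½⟨ψ, Δ^{(1),Lε}(B₁)ψ⟩` with `C^{(0)}(B₁)⁻¹` = p35's `precOpA … 0` and `Δ^{(1)}` = p35's `deltaKA … 1`.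
§2 (3.48): `transl348` = the translation WITH BODY at every level `k` (`φ′ + a(L^{k+1}ε)⁻²C^{(k),L^kε}(Ω,B)Q*(B)ψ`, `C^{(k)}` =
   p35's `fluctCovA`, `Q*` = `avgQAdjLin`, i.e. `φ′ + statPt`); `transl348_eq_transl310`: it IS r12's schematic `transl310` at the
   concrete operators; CONSUMED at (3.50)–(3.51): **`form348_split`** — the quadratic form of (3.38) in `ψ, φ` at
   `φ = transl348 φ′ ψ` is `½⟨ψ, Δ^{(k+1)}(B)ψ⟩ + ½⟨φ′, C^{(k)}(B)⁻¹φ′⟩` (`k < K`; `m² > 0`, `a > 0`, `L > 1`).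
§3 (3.30)–(3.32): `zScalA` = (3.32) at a GENERAL background (p14's `B1Eq331Model.zScal` is its value at `A^{(k),ε} = 0`,
   `zScalA_zero`); **`action330C`** = (3.30) WITH BODY: `−log Z_k − log Z_k(A^{(k),ε}) + ½⟨A,Δ^{(k)}A⟩ + ½⟨φ,Δ^{(k)}(A^{(k),ε})φ⟩ −
   𝒫^{(k)}(A^{(k),ε},φ) + E₀` with `Z_k` = p14's `zVec`, `A^{(k),ε}` = the typer's `B1Eq31Concrete.bgVec` ((3.29)), `Δ^{(k)}` (vector)
   = the typer's `HiggsFluctMeasure.deltaK`, `Δ^{(k)}(A^{(k),ε})` = p35's `deltaKA`, and print's own still-to-be-described symbol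
   `𝒫^{(k)}` (p. 617: *"The most difficult task is to describe 𝒫^{(k),L^kε}(A^{(k),ε}, φ)"*, Props. 3.1–3.2) and the constant `E₀` of (1.12)–(1.13)
   as PARAMETERS; `action330C_eq_action330`: it IS r12's `action330` at these constituents (rfl); CONSUMED at (3.37)–(3.38):
   **`eq338_action330C`** — p14's `B1Eq338Display.eq338` (the rescaling of the `(k+1)`-st step integral to the unit lattice
   giving the printed bracket (3.38)) APPLIES to `action330C` with no hypothesis left (its `hS` is `rfl`).
HONEST SCOPE.  (a) `Ω` (Neumann region of p35's operators) is a parameter — print uses `Ω = T_ε` (p. 610); in §3 `Ω = T_ε`;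
(b) the backgrounds `B₁`, `B` of §§1–2 are arbitrary vector fields on `T_ε` (print: `B^{(1)}` of (3.10) = the typer's
`B1Eq31Concrete.bgVec μ₀² a 1 B`, `B^{(k+1)}`); (c) `𝒫^{(k)}`, `E₀` are parameters of `action330C` (see §3); (d) nothing
quantitative (no bound, no convergence statement) — definitions with bodies and algebraic identities only.
-/

open scoped BigOperators InnerProductSpace

namespace Literature.MathematicalPhysics.QuantumFieldTheory.Balaban1983to89.B1Sect3FormsConcrete

open HiggsLattice HiggsAveraging HiggsCovariance HiggsRescaling HiggsDoubleRT B1Eq27StepAdjoint B1Eq230FluctCov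
  B2Eq227CondDelta B1Eq218Model B1Eq338Rescaling B1Eq338Display
open B1Eq221GaussStep (jointExp jointA schurForm IsStationary jointExp_add_of_isStationary)
open B3MultiscaleFields (toSite zeroCharge)
open B1Sect3Statements (action330 transl310)

noncomputable section

variable {P : HiggsLattice.Params} {N : ℕ}

/-! ## §1 (3.17): the basic quadratic form of the first step, on the carrier -/

section Form317

variable (C : ChargeData N) (Ω : Finset (HiggsLattice.Site P 0)) (msq a : ℝ)

/-- **(3.17)** p. 615 [PDF 13], verbatim: *"the basic quadratic form ½aL^{d−2} Σ_{y∈T′₁} |ψ(y) − (Q(B^{(1)})φ)(y)|² +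
½⟨φ, (−Δ_{B^{(1)}} + m²ε²)φ⟩ (3.17)"* — on level `0` of the `ε`-family: `½·a(Lε)^{d−2}·Σ_y ‖ψ(y) − (Q(B₁)φ)(y)‖² +
½⟨φ, (−Δ^{ε,N}_{B₁,Ω} + m²)φ⟩` (`a(Lε)^{d−2}` = `B1RT.prec a (Lε) d`, the precision of the kernel (2.6); `Q(B₁)` =
`HiggsAveraging.avgQ`; the operator = `HiggsCovariance.delta0`, (2.17); scalar product (1.5)).  On the unit lattice this is
the printed bracket letter for letter (`form317_unit`). [cite: Balaban1982Higgs1, (3.17) p.615] -/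
def form317 (B₁ : HiggsLattice.VecField P 0) (ψ : ScalarField P 1 N) (φ : ScalarField P 0 N) : ℝ :=
  1 / 2 * B1RT.prec a (P.mesh 1) P.d * ∑ y, ‖ψ y - avgQ C B₁ φ y‖ ^ 2
    + 1 / 2 * siteInner φ (delta0 C Ω B₁ msq φ)

/-- **(3.17) on the UNIT lattice** (spacing `1` at level `0`, `L` at level `1`): the prefactor is literally `aL^{d−2}` and the
operator is `−Δ^{1,N}_{B₁,Ω} + msq` with `msq` ↤ `m²ε²` (p. 614 top: *"the scalar product and the operators are defined on
the unit lattice"*). [cite: Balaban1982Higgs1, (3.17) p.615] -/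
theorem form317_unit {P₁ : HiggsLattice.Params} (h1 : P₁.mesh 0 = 1) (C₁ : ChargeData N)
    (Ω₁ : Finset (HiggsLattice.Site P₁ 0)) (msq a : ℝ) (B₁ : HiggsLattice.VecField P₁ 0) (ψ : ScalarField P₁ 1 N)
    (φ : ScalarField P₁ 0 N) :
    form317 C₁ Ω₁ msq a B₁ ψ φ
      = 1 / 2 * (a * (P₁.L : ℝ) ^ ((P₁.d : ℤ) - 2)) * ∑ y, ‖ψ y - avgQ C₁ B₁ φ y‖ ^ 2
        + 1 / 2 * siteInner φ (delta0 C₁ Ω₁ B₁ msq φ) := by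
  have hL : P₁.mesh 1 = P₁.L := by rw [B1Eq338Rescaling.mesh_succ, h1, mul_one]
  unfold form317
  rw [hL, B1RT.prec_eq]

/-- **(3.17) IS the exponent the renormalization step integrates**: `form317 = ½·jointExp(a(Lε)^{d−2}, Q(B₁), ⟨·,Δ^{(0)}(B₁)·⟩)`
— p34's joint exponent (`B1Eq221GaussStep.jointExp`, *"κΣ_y|ψ(y) − (Qφ)(y)|² + ⟨φ,Hφ⟩"*) at the linear averaging
`B1Eq27StepAdjoint.avgQLin C B₁ 0` and r14's `B1Eq218Model.deltaForm … 0` (the form of `Δ^{(0),ε}(Ω,B₁) = −Δ^{ε,N}_{B₁,Ω} + m²`,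
p35's `deltaKA … 0`), i.e. the exponent of the integrand of `T^ε_{a,L,B₁}[exp(−½⟨φ, Δ^{(0)}φ⟩)]` of (2.18)/(3.7).
[cite: Balaban1982Higgs1, (3.17) p.615, (2.18) p.610] -/
theorem form317_eq_half_jointExp (B₁ : HiggsLattice.VecField P 0) (ψ : ScalarField P 1 N) (φ : ScalarField P 0 N) :
    form317 C Ω msq a B₁ ψ φ
      = 1 / 2 * jointExp (B1RT.prec a (P.mesh 1) P.d) (avgQLin C B₁ 0) (deltaForm C Ω B₁ msq a 0) ψ φ := by
  unfold form317 jointExp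
  rw [deltaForm_apply, deltaKA_zero]
  simp only [avgQLin_apply]
  ring

/-- **(3.17) in part II's letters**: `form317 = −stepExp245(j = 0)` — the typer's scalar Gaussian exponent of II (2.45)
(`B2Eq246ScalarStep.stepExp245`: `−½a(Lε)⁻²‖ψ − Q(B₁)φ‖²_{T^{(1)}} − ½⟨φ, Δ^{(0)}φ⟩`, the block norm written with the weighted
scalar product (1.5) of `T^{(1)}`: `a(Lε)^{d−2}Σ_y = a(Lε)⁻²⟨·,·⟩_{T^{(1)}}`, r14's `B1Eq218Model.prec_mul_sum_inner`).
[cite: Balaban1982Higgs1, (3.17) p.615] -/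
theorem form317_eq_neg_stepExp245 (B₁ : HiggsLattice.VecField P 0) (ψ : ScalarField P 1 N) (φ : ScalarField P 0 N) :
    form317 C Ω msq a B₁ ψ φ = -B2Eq246ScalarStep.stepExp245 C Ω B₁ msq a 0 ψ φ := by
  have h : B1RT.prec a (P.mesh 1) P.d * ∑ y, ‖ψ y - avgQ C B₁ φ y‖ ^ 2
      = stepCoef P a 0 * siteInner (ψ - avgQLin C B₁ 0 φ) (ψ - avgQLin C B₁ 0 φ) := by
    rw [← B1Eq218Model.prec_mul_sum_inner (P := P) a 0]
    congr 1
    refine Finset.sum_congr rfl fun y _ => ?_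
    rw [Pi.sub_apply, avgQLin_apply, real_inner_self_eq_norm_sq]
  unfold form317 B2Eq246ScalarStep.stepExp245
  rw [deltaKA_zero, mul_assoc (1 / 2 : ℝ) (B1RT.prec a (P.mesh 1) P.d), h]
  ring

/-- **(3.17) → (3.18)–(3.19) ON THE CARRIER** (p. 615: *"φ = φ′ + aL⁻²C^{(0)}(B^{(1)})Q*(B^{(1)})ψ =: φ′ + ψ^{(1)} (3.18) …
= ½⟨ψ, Δ^{(1),L}(B^{(1)})ψ⟩ + ½⟨φ′, C^{(0)}(B^{(1)})⁻¹φ′⟩ (3.19)"*): after the translation by r14's `B1Eq218Model.statPt … 0 ψ`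
(= `ψ^{(1)} = a(Lε)⁻²C^{(0),ε}(Ω,B₁)Q*(B₁)ψ`, p35's `fluctCovA … 0`, the typer's `avgQAdjLin`) the form (3.17) SPLITS as
printed: `½⟨φ′, (a(Lε)⁻²P(B₁) + Δ^{(0)})φ′⟩` (= `½⟨φ′, C^{(0)}(B₁)⁻¹φ′⟩`, p35's `precOpA … 0`, (2.30)) plus
`½⟨ψ, Δ^{(1),Lε}(Ω,B₁)ψ⟩` (p35's `deltaKA … 1`, (2.21) at level 1); `m² > 0`, `a > 0`, `L > 1`.  PROVED (p34's completing of
the square `jointExp_add_of_isStationary` at r14's stationary point, `schurForm_statPt`, the typer's `condDelta227_univ_zero`).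
[cite: Balaban1982Higgs1, (3.18)–(3.19) p.615] -/
theorem form317_transl {msq a : ℝ} (hmsq : 0 < msq) (ha : 0 < a) (hL : 1 < (P.L : ℝ))
    (B₁ : HiggsLattice.VecField P 0) (ψ : ScalarField P 1 N) (φ' : ScalarField P 0 N) :
    form317 C Ω msq a B₁ ψ (statPt C Ω B₁ msq a 0 ψ + φ')
      = 1 / 2 * siteInner φ' (precOpA C Ω B₁ msq a 0 φ') + 1 / 2 * siteInner ψ (deltaKA C Ω B₁ msq a 1 ψ) := by
  rw [form317_eq_half_jointExp,
    jointExp_add_of_isStationary (deltaForm_symm C Ω B₁ msq a 0)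
      (isStationary_statPt C Ω B₁ hmsq ha hL (Nat.zero_le _) ψ) φ',
    jointA_self_eq, schurForm_statPt, condDelta227_univ_zero C Ω B₁ hL msq a]
  ring

end Form317

/-! ## §2 (3.48): the translation of the scalar field in the `(k+1)`-st step, on the carrier -/

section Transl348

variable (C : ChargeData N) (Ω : Finset (HiggsLattice.Site P 0)) (msq a : ℝ)

/-- **(3.48)** p. 621 [PDF 19], verbatim: *"Now we will do a translation in the fields φ. The translation has the form φ = φ′ +
aL⁻²C^{(k)}(B^{(k+1)})Q*(B^{(k+1)})ψ, (3.48)"* —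
WITH BODY at every level `k` of the `ε`-family: `φ′ + a(L^{k+1}ε)⁻²·C^{(k),L^kε}(Ω,B)(Q*(B)ψ)` with `C^{(k)}` = p35's
`B1Eq230FluctCov.fluctCovA` ((2.30)), `Q*` = the typer's `B1Eq27StepAdjoint.avgQAdjLin`, i.e. `φ′ +` r14's stationary point
`B1Eq218Model.statPt` (the same shift as (3.10)/(3.18)/(3.29), p. 614). [cite: Balaban1982Higgs1, (3.48) p.621] -/
def transl348 (k : ℕ) (B : HiggsLattice.VecField P 0) (φ' : ScalarField P k N) (ψ : ScalarField P (k + 1) N) :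
    ScalarField P k N :=
  φ' + statPt C Ω B msq a k ψ

/-- (3.48) unfolded: `φ = φ′ + a(L^{k+1}ε)⁻²·C^{(k)}(B)(Q*(B)ψ)` (`stepCoef P a k = a(L^{k+1}ε)⁻²`; `= aL⁻²` on the unit lattice).
[cite: Balaban1982Higgs1, (3.48) p.621] -/
theorem transl348_eq (k : ℕ) (B : HiggsLattice.VecField P 0) (φ' : ScalarField P k N) (ψ : ScalarField P (k + 1) N) :
    transl348 C Ω msq a k B φ' ψ = φ' + stepCoef P a k • fluctCovA C Ω B msq a k (avgQAdjLin C B k ψ) := by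
  unfold transl348 statPt
  rw [map_smul]

/-- **(3.48) concrete = (3.48) schematic**: `transl348` IS r12's `B1Sect3Statements.transl310` (the common shape of (3.10),
(3.18), (3.41), (3.48)) at `c = a(L^{k+1}ε)⁻²`, `C = C^{(k),L^kε}(Ω,B)`, `Q* = Q*(B)`. [cite: Balaban1982Higgs1, (3.48) p.621] -/
theorem transl348_eq_transl310 (k : ℕ) (B : HiggsLattice.VecField P 0) (φ' : ScalarField P k N)
    (ψ : ScalarField P (k + 1) N) :
    transl348 C Ω msq a k B φ' ψ
      = transl310 (stepCoef P a k) (fluctCovA C Ω B msq a k : Module.End ℝ (ScalarField P k N))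
          (avgQAdjLin C B k) φ' ψ := by
  rw [transl348_eq]
  rfl

/-- The basic quadratic form for scalar fields of the bracket (3.38) p. 619, `½aL^{d−2}Σ_y|ψ(y) − (Q(B)φ)(y)|² + ½⟨φ, Δ^{(k)}(B)φ⟩`
(the scalar part of the bracket (3.38) at the background `B` = `A^{(k)}`), on the `L^kε`-lattice: `½·jointExp(a(L^{k+1}ε)^{d−2},
Q(B), ⟨·,Δ^{(k),L^kε}(Ω,B)·⟩)` unfolded. [cite: Balaban1982Higgs1, (3.38) p.619, (3.48) p.621] -/
theorem half_jointExp_eq (k : ℕ) (B : HiggsLattice.VecField P 0) (ψ : ScalarField P (k + 1) N) (φ : ScalarField P k N) :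
    1 / 2 * jointExp (B1RT.prec a (P.mesh (k + 1)) P.d) (avgQLin C B k) (deltaForm C Ω B msq a k) ψ φ
      = 1 / 2 * B1RT.prec a (P.mesh (k + 1)) P.d * ∑ y, ‖ψ y - avgQ C B φ y‖ ^ 2
          + 1 / 2 * siteInner φ (deltaKA C Ω B msq a k φ) := by
  unfold jointExp
  rw [deltaForm_apply]
  simp only [avgQLin_apply]
  ring

/-- **(3.48) → (3.50)–(3.51) ON THE CARRIER** (p. 621: the translation (3.48) *"separates again the basic quadratic form for
scalar fields into a sum of the corresponding forms in the fields ψ and φ′"* — the forms displayed in (3.51),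
`½⟨ψ, Δ^{(k+1),L}(B^{(k+1)})ψ⟩` and `½⟨φ′, (C^{(k)}(B^{(k+1)}))⁻¹φ′⟩`): at `φ = transl348 φ′ ψ` the form is
`½⟨φ′, (a(L^{k+1}ε)⁻²P(B) + Δ^{(k)})φ′⟩ + ½⟨ψ, Δ^{(k+1),L^{k+1}ε}(Ω,B)ψ⟩` (`C^{(k)}(B)⁻¹` = p35's `precOpA … k`, `Δ^{(k+1)}` =
p35's `deltaKA … (k+1)` via the typer's `condDelta227_univ_eq_deltaKA`); `k < K`, `m² > 0`, `a > 0`, `L > 1`.  PROVED.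
[cite: Balaban1982Higgs1, (3.48)–(3.51) p.621] -/
theorem form348_split {msq a : ℝ} (hmsq : 0 < msq) (ha : 0 < a) (hL : 1 < (P.L : ℝ)) {k : ℕ} (hk : k < P.K)
    (B : HiggsLattice.VecField P 0) (ψ : ScalarField P (k + 1) N) (φ' : ScalarField P k N) :
    1 / 2 * jointExp (B1RT.prec a (P.mesh (k + 1)) P.d) (avgQLin C B k) (deltaForm C Ω B msq a k) ψ
        (transl348 C Ω msq a k B φ' ψ)
      = 1 / 2 * siteInner φ' (precOpA C Ω B msq a k φ') + 1 / 2 * siteInner ψ (deltaKA C Ω B msq a (k + 1) ψ) := by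
  unfold transl348
  rw [add_comm φ' _,
    jointExp_add_of_isStationary (deltaForm_symm C Ω B msq a k) (isStationary_statPt C Ω B hmsq ha hL hk.le ψ) φ',
    jointA_self_eq, schurForm_statPt, condDelta227_univ_eq_deltaKA C Ω B hmsq ha hL hk]
  ring

end Transl348

/-! ## §3 (3.30)–(3.32): the k-th action, on the carrier -/

section Action330

variable (C : ChargeData N) (msq mu0sq a : ℝ)

variable (P) in
/-- **(3.32)** p. 617 at a GENERAL background `A^{(k),ε}` (`Abg`): `Z_k(A^{(k),ε}) = (a_k(L^kε)^{d−2}/2π)^{(N/2)|T₁^{(k)}|}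
∫dφ exp(−½⟨φ, (G^ε_k(A^{(k),ε}))⁻¹φ⟩)` — `(G^ε_k(A^{(k),ε}))⁻¹` = `HiggsCovariance.covOpK C T_ε Abg m² a k`, `dφ` = Lebesgue
measure on the scalar fields of `T_ε`, prefactor `B1RT.prec (a_k) (L^kε) d / 2π` (p14's `B1Eq331Model.zScal` is the value at
`Abg = 0`, `zScalA_zero`). [cite: Balaban1982Higgs1, (3.32) p.617] -/
def zScalA (k : ℕ) (Abg : HiggsLattice.VecField P 0) : ℝ :=
  (B1RT.prec (B1.aSeq a P.L k) (P.mesh k) P.d / (2 * Real.pi))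
      ^ ((N : ℝ) / 2 * (Fintype.card (HiggsLattice.Site P k) : ℝ))
    * ∫ φ : ScalarField P 0 N,
        Real.exp (-(1 / 2 : ℝ) * siteInner φ (covOpK C Finset.univ Abg msq a k φ))

/-- At the zero background (3.32) is p14's `B1Eq331Model.zScal` (definitional). [cite: Balaban1982Higgs1, (3.32) p.617] -/
theorem zScalA_zero (k : ℕ) : zScalA P C msq a k 0 = B1Eq331Model.zScal P C msq a k := rfl

/-- **(3.30)** p. 617 [PDF 15], verbatim: *"S^{(k),L^kε}(A, φ) = −log Z_k − log Z_k(A^{(k),ε}) + ½⟨A, Δ^{(k),L^kε}A⟩ +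
½⟨φ, Δ^{(k),L^kε}(A^{(k),ε})φ⟩ − 𝒫^{(k),L^kε}(A^{(k),ε}, φ) + E₀ (3.30)"* — WITH BODY for the fields `A, φ` of the
`L^kε`-lattice `T^{(k)}`: `Z_k` = p14's `B1Eq331Model.zVec` ((3.31)), `Z_k(A^{(k),ε})` = `zScalA` ((3.32)), `A^{(k),ε}` = the
typer's `B1Eq31Concrete.bgVec μ₀² a k A` ((3.29)), `Δ^{(k),L^kε}` (vector field, I p. 608 *"N = d … A = 0"*) = the typer's
`HiggsFluctMeasure.deltaK P μ₀² a k` on `toSite A`, `Δ^{(k),L^kε}(A^{(k),ε})` = p35's `B1Eq230FluctCov.deltaKA C T_ε A^{(k),ε} m² a k`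
((2.21)); print's own not-yet-described symbol `𝒫^{(k)}` (p. 617: *"The most difficult task is to describe 𝒫^{(k),L^kε}(A^{(k),ε},
φ)"*; Props. 3.1–3.2) and the constant `E₀` of (1.12)–(1.13) enter as the PARAMETERS `Pk`, `E₀`.
[cite: Balaban1982Higgs1, (3.30) p.617] -/
def action330C (k : ℕ) (E₀ : ℝ) (Pk : HiggsLattice.VecField P 0 → ScalarField P k N → ℝ)
    (A : HiggsLattice.VecField P k) (φ : ScalarField P k N) : ℝ :=
  -Real.log (B1Eq331Model.zVec P mu0sq a k)
    - Real.log (zScalA P C msq a k (B1Eq31Concrete.bgVec mu0sq a k A))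
    + 1 / 2 * siteInner (toSite A) (HiggsFluctMeasure.deltaK P mu0sq a k (toSite A))
    + 1 / 2 * siteInner φ (deltaKA C Finset.univ (B1Eq31Concrete.bgVec mu0sq a k A) msq a k φ)
    - Pk (B1Eq31Concrete.bgVec mu0sq a k A) φ + E₀

/-- **(3.30) concrete = (3.30) schematic**: `action330C` IS r12's `B1Sect3Statements.action330` at its six concrete
constituents (definitional). [cite: Balaban1982Higgs1, (3.30) p.617] -/
theorem action330C_eq_action330 (k : ℕ) (E₀ : ℝ) (Pk : HiggsLattice.VecField P 0 → ScalarField P k N → ℝ)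
    (A : HiggsLattice.VecField P k) (φ : ScalarField P k N) :
    action330C C msq mu0sq a k E₀ Pk A φ
      = action330 (Real.log (B1Eq331Model.zVec P mu0sq a k))
          (Real.log (zScalA P C msq a k (B1Eq31Concrete.bgVec mu0sq a k A)))
          (siteInner (toSite A) (HiggsFluctMeasure.deltaK P mu0sq a k (toSite A)))
          (siteInner φ (deltaKA C Finset.univ (B1Eq31Concrete.bgVec mu0sq a k A) msq a k φ))
          (Pk (B1Eq31Concrete.bgVec mu0sq a k A) φ) E₀ := rfl

/-- `action330C` has the shape p14's (3.38)-theorem asks of the k-th action (`B1Eq338Display.eq338`'s hypothesis `hS`), with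
the background assignment `A ↦ A^{(k),ε}` = `bgVec μ₀² a k` (definitional). [cite: Balaban1982Higgs1, (3.30) p.617, (3.38) p.619] -/
theorem action330C_hS (k : ℕ) (E₀ : ℝ) (Pk : HiggsLattice.VecField P 0 → ScalarField P k N → ℝ) :
    ∀ (A : HiggsLattice.VecField P k) (φ : ScalarField P k N),
      action330C C msq mu0sq a k E₀ Pk A φ
        = action330 (Real.log (B1Eq331Model.zVec P mu0sq a k))
            ((fun Ab : HiggsLattice.VecField P 0 => Real.log (zScalA P C msq a k Ab)) (B1Eq31Concrete.bgVec mu0sq a k A))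
            ((fun A : HiggsLattice.VecField P k => siteInner (toSite A) (HiggsFluctMeasure.deltaK P mu0sq a k (toSite A))) A)
            ((fun (Ab : HiggsLattice.VecField P 0) (φ : ScalarField P k N) =>
                siteInner φ (deltaKA C Finset.univ Ab msq a k φ)) (B1Eq31Concrete.bgVec mu0sq a k A) φ)
            (Pk (B1Eq31Concrete.bgVec mu0sq a k A) φ) E₀ :=
  fun _ _ => rfl

/-- **(3.30) CONSUMED at (3.37)–(3.38) ON THE CARRIER**: p14's `B1Eq338Display.eq338` — *"After the rescaling the integral
transforms into … (3.38)"* with the k-th action of the form (3.30) — APPLIES to `action330C` with no hypothesis left: for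
every outer/inner weight (↤ `χ_{k+1}χ_{k+1}`, `χ_kχ_k`) and unit-lattice block fields `B′, ψ′`,
`χ′(σB′,σψ′)·T^{L^kε}_{a,L}[T^{L^kε}_{a,L,A^{(k),ε}}[χ e^{−S^{(k),L^kε}}]](σB′, σψ′) = display338(B′, ψ′)` with `S^{(k),L^kε} =
action330C`, the background `A ↦ A^{(k),ε}` = `bgVec μ₀² a k` and the pulled-back constituents. [cite: Balaban1982Higgs1, (3.38) p.619] -/
theorem eq338_action330C {k : ℕ} (E₀ : ℝ) (Pk : HiggsLattice.VecField P 0 → ScalarField P k N → ℝ)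
    (χk1 : HiggsLattice.VecField P (k + 1) → ScalarField P (k + 1) N → ℝ)
    (χk : HiggsLattice.VecField P k → ScalarField P k N → ℝ)
    (B' : HiggsLattice.VecField (P.scaleBy (unitScale P k) (unitScale_pos P k)) (k + 1))
    (ψ' : ScalarField (P.scaleBy (unitScale P k) (unitScale_pos P k)) (k + 1) N) :
    χk1 (rescaleVec (unitScale_pos P k) B') (rescaleScalar (unitScale_pos P k) ψ')
        * doubleRTk C a (B1Eq31Concrete.bgVec mu0sq a k)
            (fun A φ => χk A φ * Real.exp (-action330C C msq mu0sq a k E₀ Pk A φ))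
            (rescaleVec (unitScale_pos P k) B') (rescaleScalar (unitScale_pos P k) ψ')
      = display338 (P.scaleBy (unitScale P k) (unitScale_pos P k)) k (C.scaleBy P.d (unitScale P k)) a
          (rescaleConstK P k N a (unitScale P k))
          (fun B ψ => χk1 (rescaleVec (unitScale_pos P k) B) (rescaleScalar (unitScale_pos P k) ψ))
          (fun A φ => χk (rescaleVec (unitScale_pos P k) A) (rescaleScalar (unitScale_pos P k) φ))
          (extRescale (unitScale_pos P k) (B1Eq31Concrete.bgVec mu0sq a k))
          (Real.log (B1Eq331Model.zVec P mu0sq a k))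
          (fun Ab => Real.log (zScalA P C msq a k (rescaleVec (unitScale_pos P k) Ab)))
          (fun A => siteInner (toSite (rescaleVec (unitScale_pos P k) A))
            (HiggsFluctMeasure.deltaK P mu0sq a k (toSite (rescaleVec (unitScale_pos P k) A))))
          (fun Ab φ => siteInner (rescaleScalar (unitScale_pos P k) φ)
            (deltaKA C Finset.univ (rescaleVec (unitScale_pos P k) Ab) msq a k (rescaleScalar (unitScale_pos P k) φ)))
          (fun Ab φ => Pk (rescaleVec (unitScale_pos P k) Ab) (rescaleScalar (unitScale_pos P k) φ)) E₀ B' ψ' := by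
  have h := eq338 C a (B1Eq31Concrete.bgVec mu0sq a k) χk1 χk
    (S := action330C C msq mu0sq a k E₀ Pk) (logZk := Real.log (B1Eq331Model.zVec P mu0sq a k)) (E₀ := E₀)
    (logZkA := fun Ab : HiggsLattice.VecField P 0 => Real.log (zScalA P C msq a k Ab))
    (formA := fun A : HiggsLattice.VecField P k =>
      siteInner (toSite A) (HiggsFluctMeasure.deltaK P mu0sq a k (toSite A)))
    (formφ := fun (Ab : HiggsLattice.VecField P 0) (φ : ScalarField P k N) =>
      siteInner φ (deltaKA C Finset.univ Ab msq a k φ))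
    (Pk := Pk) (action330C_hS C msq mu0sq a k E₀ Pk) B' ψ'
  beta_reduce at h
  exact h

end Action330

end

end Literature.MathematicalPhysics.QuantumFieldTheory.Balaban1983to89.B1Sect3FormsConcrete
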